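import Summits.AtomisticToContinuum.FouriersLaw.Theorems.BondHeatUncertaintyBoundedResponseEnergyFluctuationA
import HarnessLib

/-!
# `BondHeatUncertainty.BoundedResponse` — (V) `EnergyFluctuationExtensive` PROVED, PART B of three (lens-1 g95, NODE 95E storage grade)

PART B: the Brascamp–Lieb moment ladder `moments_le` (§V.2 tail), §V.3 (closed form and per-site bound of `∂ᵢU_N`; defs `sitePoly`, `gradConst`),
§V.4 (`potFluct_le`).  Statement, constant and proof outline §V.1–§V.6: see PART A (`…BondHeatUncertaintyBoundedResponseEnergyFluctuationA`).
Bodies verbatim from the verified single file (sha256 951a9e83…, critic row 1357); 0 sorry; standard axioms; every declaration carries a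
docstring.  Landing form (hand-2 lane): `--supports stmt-AtomisticToContinuum-11071`.
-/

noncomputable section

open MeasureTheory ProbabilityTheory Filter Topology Set Function
open scoped NNReal ENNReal ContDiff RealInnerProductSpace
open Literature.MathematicalPhysics.KineticTheory.HeatConduction
open Literature.MathematicalPhysics.KineticTheory OscillatorChain

namespace Summit.AtomisticToContinuum.FouriersLaw.Theorems.BoundedResponse.ParityFloor

section EnergyFluctuation

variable {ω₂ lam β γ T : ℝ}

section Position

variable {N : ℕ}

/-- **The Brascamp–Lieb moment ladder** (uniform in the site and in `N`): with `Z = ∫ w` and `c = T/ω₂`,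
`∫ qᵢ² w ≤ c·Z`, `∫ qᵢ⁴ w ≤ 10c²·Z`, `∫ qᵢ⁶ w ≤ 90c³·Z` (Poincaré for `f = qᵢ, qᵢ², qᵢ³`; odd means vanish by symmetry).
[cite: BrascampLieb1976, Thm 4.1] -/
theorem moments_le (hω : 0 < ω₂) (hl : 0 ≤ lam) (hβ : 0 ≤ β) (hT : 0 < T) (i : Fin N) :
    (∫ q, q i ^ 2 * potWeight ω₂ lam β T N q ≤ T / ω₂ * ∫ q, potWeight ω₂ lam β T N q) ∧
    (∫ q, q i ^ 4 * potWeight ω₂ lam β T N q ≤ 10 * (T / ω₂) ^ 2 * ∫ q, potWeight ω₂ lam β T N q) ∧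
    (∫ q, q i ^ 6 * potWeight ω₂ lam β T N q ≤ 90 * (T / ω₂) ^ 3 * ∫ q, potWeight ω₂ lam β T N q) := by
  set Z : ℝ := ∫ q, potWeight ω₂ lam β T N q with hZ
  have hZ0 : 0 < Z := integral_potWeight_pos hω hl hβ hT
  have hw := integrable_potWeight (N := N) hω hl hβ hT
  have hc : 0 < T / ω₂ := div_pos hT hω
  have hm : ∀ {k : ℕ}, k ≤ 6 → Integrable fun q => q i ^ k * potWeight ω₂ lam β T N q :=
    fun hk => integrable_pow_mul_potWeight hω hl hβ hT i hk
  -- f = qᵢ : odd ⇒ mean zero, |∇f|² = 1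
  have e1 : ∀ q : Fin N → ℝ, (∑ j, coordDeriv j (fun q : Fin N → ℝ => q i) q ^ 2) = 1 := fun q => by
    have h := sum_coordDeriv_pow_sq i 1 q
    simp only [pow_one] at h
    rw [h]
    simp
  have h1a : Integrable fun q => q i * potWeight ω₂ lam β T N q := by
    simpa only [pow_one] using hm (k := 1) (by norm_num)
  have key1 := potWeight_poincare hω hl hβ hT N (fun q => q i) (contDiff_apply ℝ ℝ i) h1a
    (hm (k := 2) (by norm_num)) (by simp only [e1, one_mul]; exact hw)
  have h01 : ∫ q, q i * potWeight ω₂ lam β T N q = 0 := integral_odd_mul_potWeight (fun q => by simp)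
  simp only [e1, one_mul, h01, zero_div, sub_zero] at key1
  have h2 : ∫ q, q i ^ 2 * potWeight ω₂ lam β T N q ≤ T / ω₂ * Z := key1
  have hM2 : 0 ≤ ∫ q, q i ^ 2 * potWeight ω₂ lam β T N q :=
    integral_nonneg fun q => mul_nonneg (sq_nonneg _) (potWeight_pos _ _ _ _ _ _).le
  -- f = qᵢ² : |∇f|² = 4qᵢ²
  have e2 : ∀ q : Fin N → ℝ, (∑ j, coordDeriv j (fun q : Fin N → ℝ => q i ^ 2) q ^ 2) =
      4 * q i ^ 2 := fun q => by
    rw [sum_coordDeriv_pow_sq]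
    norm_num
    ring
  have h4a : Integrable fun q => (q i ^ 2) ^ 2 * potWeight ω₂ lam β T N q := by
    simpa only [← pow_mul] using hm (k := 4) (by norm_num)
  have key2 := potWeight_poincare hω hl hβ hT N (fun q => q i ^ 2) ((contDiff_apply ℝ ℝ i).pow 2)
    (hm (k := 2) (by norm_num)) h4a
    (by simp only [e2, mul_assoc]; exact (hm (k := 2) (by norm_num)).const_mul 4)
  simp only [e2, mul_assoc, integral_const_mul] at key2
  set m₂ : ℝ := (∫ q, q i ^ 2 * potWeight ω₂ lam β T N q) / Z with hm₂
  obtain ⟨-, hsq2⟩ := integral_sq_mul_le_of_centred (f := fun q => q i ^ 2) m₂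
    (hm (k := 2) (by norm_num)) h4a hw
  have hm₂Z : m₂ ^ 2 * Z ≤ (T / ω₂) ^ 2 * Z := by
    have e : m₂ ^ 2 * Z = (∫ q, q i ^ 2 * potWeight ω₂ lam β T N q) ^ 2 / Z := by
      rw [hm₂]; field_simp
    rw [e, div_le_iff₀ hZ0]
    have := pow_le_pow_left₀ hM2 h2 2
    nlinarith [this, hZ0]
  have h4 : ∫ q, q i ^ 4 * potWeight ω₂ lam β T N q ≤ 10 * (T / ω₂) ^ 2 * Z := by
    have e : ∫ q, q i ^ 4 * potWeight ω₂ lam β T N q = ∫ q, (q i ^ 2) ^ 2 * potWeight ω₂ lam β T N q := by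
      simp only [← pow_mul]
    rw [e]
    have h4b : T / ω₂ * (4 * ∫ q, q i ^ 2 * potWeight ω₂ lam β T N q) ≤ T / ω₂ * (4 * (T / ω₂ * Z)) := by
      gcongr
    linarith [hsq2, key2, h4b, hm₂Z]
  -- f = qᵢ³ : odd ⇒ mean zero, |∇f|² = 9qᵢ⁴
  have e3 : ∀ q : Fin N → ℝ, (∑ j, coordDeriv j (fun q : Fin N → ℝ => q i ^ 3) q ^ 2) =
      9 * q i ^ 4 := fun q => by
    rw [sum_coordDeriv_pow_sq]
    norm_num
    ring
  have h6a : Integrable fun q => (q i ^ 3) ^ 2 * potWeight ω₂ lam β T N q := by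
    simpa only [← pow_mul] using hm (k := 6) (by norm_num)
  have key3 := potWeight_poincare hω hl hβ hT N (fun q => q i ^ 3) ((contDiff_apply ℝ ℝ i).pow 3)
    (hm (k := 3) (by norm_num)) h6a
    (by simp only [e3, mul_assoc]; exact (hm (k := 4) (by norm_num)).const_mul 9)
  have h03 : ∫ q, q i ^ 3 * potWeight ω₂ lam β T N q = 0 :=
    integral_odd_mul_potWeight (fun q => by simp only [Pi.neg_apply]; ring)
  simp only [e3, mul_assoc, integral_const_mul, h03, zero_div, sub_zero] at key3
  have h6 : ∫ q, q i ^ 6 * potWeight ω₂ lam β T N q ≤ 90 * (T / ω₂) ^ 3 * Z := by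
    have e : ∫ q, q i ^ 6 * potWeight ω₂ lam β T N q = ∫ q, (q i ^ 3) ^ 2 * potWeight ω₂ lam β T N q := by
      simp only [← pow_mul]
    rw [e]
    have h6b : T / ω₂ * (9 * ∫ q, q i ^ 4 * potWeight ω₂ lam β T N q) ≤ T / ω₂ * (9 * (10 * (T / ω₂) ^ 2 * Z)) := by
      gcongr
    linarith [key3, h6b]
  exact ⟨h2, h4, h6⟩

/-! ### §V.3 The gradient of `U_N`: closed form and a per-site polynomial bound -/

/-- The site polynomial `Λ(s) = 1 + s² + s⁶` that controls `|∂ᵢU_N|²`. -/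
def sitePoly (s : ℝ) : ℝ := 1 + s ^ 2 + s ^ 6

/-- `Λ ≥ 0`. [folklore] -/
theorem sitePoly_nonneg (s : ℝ) : 0 ≤ sitePoly s := by
  unfold sitePoly; positivity

/-- `∫ Λ(qᵢ) w ≤ (1 + c + 90c³) Z`, `c = T/ω₂` (the moment ladder). [cite: BrascampLieb1976, Thm 4.1] -/
theorem integral_sitePoly_mul_potWeight_le (hω : 0 < ω₂) (hl : 0 ≤ lam) (hβ : 0 ≤ β) (hT : 0 < T)
    (i : Fin N) :
    Integrable (fun q => sitePoly (q i) * potWeight ω₂ lam β T N q) ∧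
    ∫ q, sitePoly (q i) * potWeight ω₂ lam β T N q ≤
      (1 + T / ω₂ + 90 * (T / ω₂) ^ 3) * ∫ q, potWeight ω₂ lam β T N q := by
  have hw := integrable_potWeight (N := N) hω hl hβ hT
  have h2i := integrable_pow_mul_potWeight hω hl hβ hT i (k := 2) (by norm_num)
  have h6i := integrable_pow_mul_potWeight hω hl hβ hT i (k := 6) (by norm_num)
  obtain ⟨h2, -, h6⟩ := moments_le (N := N) hω hl hβ hT i
  have hI : Integrable (fun q => sitePoly (q i) * potWeight ω₂ lam β T N q) := by
    have := (hw.add h2i).add h6i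
    refine this.congr (Eventually.of_forall fun q => ?_)
    simp only [Pi.add_apply, sitePoly]
    ring
  refine ⟨hI, ?_⟩
  have hA := integral_add hw h2i
  have hB := integral_add (hw.add h2i) h6i
  simp only [Pi.add_apply] at hB
  rw [hA] at hB
  have e : ∫ q, sitePoly (q i) * potWeight ω₂ lam β T N q =
      ∫ q, (potWeight ω₂ lam β T N q + q i ^ 2 * potWeight ω₂ lam β T N q) +
        q i ^ 6 * potWeight ω₂ lam β T N q := by
    refine integral_congr_ae (Eventually.of_forall fun q => ?_)
    simp only [sitePoly]
    ring
  rw [e, hB]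
  nlinarith [h2, h6]

/-- **Closed form of `∂ᵢU_N`**: `∂ᵢU_N(q) = ω₂qᵢ + λqᵢ³ + [0<i]·V'(qᵢ − qᵢ₋₁) − [i+1<N]·V'(qᵢ₊₁ − qᵢ)`,
`V'(r) = r + βr³`. [folklore] -/
theorem coordDeriv_potEnergy (i : Fin N) (q : Fin N → ℝ) :
    coordDeriv i (potEnergy ω₂ lam β N) q =
      (ω₂ * q i + lam * q i ^ 3)
        + (if h : 0 < i.val then
            (q i - q ⟨i.val - 1, by omega⟩) + β * (q i - q ⟨i.val - 1, by omega⟩) ^ 3 else 0)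
        - (if h : i.val + 1 < N then
            (q ⟨i.val + 1, h⟩ - q i) + β * (q ⟨i.val + 1, h⟩ - q i) ^ 3 else 0) := by
  have hUd : Differentiable ℝ (pinnedChain ω₂ lam β 0).U :=
    (pinnedChain_contDiff_U ω₂ lam β 0 (n := 1)).differentiable one_ne_zero
  have hVd : Differentiable ℝ (pinnedChain ω₂ lam β 0).V :=
    (pinnedChain_contDiff_V ω₂ lam β 0 (n := 1)).differentiable one_ne_zero
  have h1 : coordDeriv i (potEnergy ω₂ lam β N) q =
      partialQ i ((pinnedChain ω₂ lam β 0).hamiltonian N) ((q, fun _ => 0) : PhaseSpace N) := rfl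
  rw [h1, (pinnedChain ω₂ lam β 0).partialQ_hamiltonian_eq_dPotential hUd hVd N _ i,
    (pinnedChain ω₂ lam β 0).dPotential_eq_closed]
  simp only [pinnedChain_deriv_U, pinnedChain_deriv_V]

/-- `(x + y − z)² ≤ 3(x² + y² + z²)`. [folklore] -/
theorem sq_add_sub_le_three (x y z : ℝ) : (x + y - z) ^ 2 ≤ 3 * (x ^ 2 + y ^ 2 + z ^ 2) := by
  nlinarith [sq_nonneg (x - y), sq_nonneg (x + z), sq_nonneg (y + z)]

/-- The pinning force squared: `(ω₂s + λs³)² ≤ 2(ω₂² + λ²)·Λ(s)`. [folklore] -/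
theorem sq_pinForce_le (s : ℝ) : (ω₂ * s + lam * s ^ 3) ^ 2 ≤ 2 * (ω₂ ^ 2 + lam ^ 2) * sitePoly s := by
  unfold sitePoly
  have h1 : (ω₂ * s + lam * s ^ 3) ^ 2 ≤ 2 * (ω₂ ^ 2 * s ^ 2) + 2 * (lam ^ 2 * s ^ 6) := by
    nlinarith [sq_nonneg (ω₂ * s - lam * s ^ 3)]
  have h2 : ω₂ ^ 2 * s ^ 2 ≤ ω₂ ^ 2 * (1 + s ^ 2 + s ^ 6) :=
    mul_le_mul_of_nonneg_left (by nlinarith [sq_nonneg (s ^ 3)]) (sq_nonneg _)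
  have h3 : lam ^ 2 * s ^ 6 ≤ lam ^ 2 * (1 + s ^ 2 + s ^ 6) :=
    mul_le_mul_of_nonneg_left (by nlinarith [sq_nonneg s]) (sq_nonneg _)
  nlinarith [h1, h2, h3]

/-- `(u + v)³ ≤ 4(u³ + v³)` for `u, v ≥ 0`. [folklore] -/
theorem add_pow_three_le {u v : ℝ} (hu : 0 ≤ u) (hv : 0 ≤ v) : (u + v) ^ 3 ≤ 4 * (u ^ 3 + v ^ 3) := by
  nlinarith [mul_nonneg (add_nonneg hu hv) (sq_nonneg (u - v))]

/-- `(s − t)⁶ ≤ 32(s⁶ + t⁶)`. [folklore] -/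
theorem sub_pow_six_le (s t : ℝ) : (s - t) ^ 6 ≤ 32 * (s ^ 6 + t ^ 6) := by
  have h2 : (s - t) ^ 2 ≤ 2 * s ^ 2 + 2 * t ^ 2 := by nlinarith [sq_nonneg (s + t)]
  have h3 : ((s - t) ^ 2) ^ 3 ≤ (2 * s ^ 2 + 2 * t ^ 2) ^ 3 := pow_le_pow_left₀ (sq_nonneg _) h2 3
  have h4 : (s ^ 2 + t ^ 2) ^ 3 ≤ 4 * ((s ^ 2) ^ 3 + (t ^ 2) ^ 3) :=
    add_pow_three_le (sq_nonneg s) (sq_nonneg t)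
  calc (s - t) ^ 6 = ((s - t) ^ 2) ^ 3 := by ring
    _ ≤ (2 * s ^ 2 + 2 * t ^ 2) ^ 3 := h3
    _ = 8 * (s ^ 2 + t ^ 2) ^ 3 := by ring
    _ ≤ 8 * (4 * ((s ^ 2) ^ 3 + (t ^ 2) ^ 3)) := by linarith
    _ = 32 * (s ^ 6 + t ^ 6) := by ring

/-- The bond force squared: `V'(s − t)² ≤ (4 + 64β²)(Λ(s) + Λ(t))`. [folklore] -/
theorem sq_bondForce_le (s t : ℝ) :
    ((s - t) + β * (s - t) ^ 3) ^ 2 ≤ (4 + 64 * β ^ 2) * (sitePoly s + sitePoly t) := by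
  unfold sitePoly
  set r := s - t with hr
  have h1 : (r + β * r ^ 3) ^ 2 ≤ 2 * r ^ 2 + 2 * (β ^ 2 * r ^ 6) := by
    nlinarith [sq_nonneg (r - β * r ^ 3)]
  have h2 : r ^ 2 ≤ 2 * s ^ 2 + 2 * t ^ 2 := by rw [hr]; nlinarith [sq_nonneg (s + t)]
  have h6 : r ^ 6 ≤ 32 * (s ^ 6 + t ^ 6) := by rw [hr]; exact sub_pow_six_le s t
  have h6' : β ^ 2 * r ^ 6 ≤ β ^ 2 * (32 * (s ^ 6 + t ^ 6)) := mul_le_mul_of_nonneg_left h6 (sq_nonneg β)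
  have hb : 0 ≤ β ^ 2 := sq_nonneg β
  have step1 : (r + β * r ^ 3) ^ 2 ≤
      4 * s ^ 2 + 4 * t ^ 2 + 64 * (β ^ 2 * s ^ 6) + 64 * (β ^ 2 * t ^ 6) := by
    linarith [h1, h2, h6']
  have hs6 : (0 : ℝ) ≤ s ^ 6 := by positivity
  have ht6 : (0 : ℝ) ≤ t ^ 6 := by positivity
  nlinarith [step1, hb, mul_nonneg hb (sq_nonneg s), mul_nonneg hb (sq_nonneg t), hs6, ht6]

/-- The constant `K₀(ω₂, λ, β) = 6(ω₂² + λ²) + 24 + 384β²` of the per-site gradient bound. -/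
def gradConst (ω₂ lam β : ℝ) : ℝ := 6 * (ω₂ ^ 2 + lam ^ 2) + 24 + 384 * β ^ 2

/-- `K₀ ≥ 0`. [folklore] -/
theorem gradConst_nonneg : 0 ≤ gradConst ω₂ lam β := by
  unfold gradConst; positivity

/-- **Per-site gradient bound**: `(∂ᵢU_N)² ≤ K₀·(Λ(qᵢ) + [0<i]Λ(qᵢ₋₁) + [i+1<N]Λ(qᵢ₊₁))`. [folklore] -/
theorem sq_coordDeriv_potEnergy_le (i : Fin N) (q : Fin N → ℝ) :
    coordDeriv i (potEnergy ω₂ lam β N) q ^ 2 ≤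
      gradConst ω₂ lam β * (sitePoly (q i)
        + (if h : 0 < i.val then sitePoly (q ⟨i.val - 1, by omega⟩) else 0)
        + (if h : i.val + 1 < N then sitePoly (q ⟨i.val + 1, h⟩) else 0)) := by
  rw [coordDeriv_potEnergy]
  set a : ℝ := ω₂ * q i + lam * q i ^ 3 with ha
  set A : ℝ := (if h : 0 < i.val then
      (q i - q ⟨i.val - 1, by omega⟩) + β * (q i - q ⟨i.val - 1, by omega⟩) ^ 3 else 0) with hA
  set B : ℝ := (if h : i.val + 1 < N then
      (q ⟨i.val + 1, h⟩ - q i) + β * (q ⟨i.val + 1, h⟩ - q i) ^ 3 else 0) with hB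
  set LA : ℝ := (if h : 0 < i.val then sitePoly (q ⟨i.val - 1, by omega⟩) else 0) with hLA
  set LB : ℝ := (if h : i.val + 1 < N then sitePoly (q ⟨i.val + 1, h⟩) else 0) with hLB
  have hL0 : 0 ≤ sitePoly (q i) := sitePoly_nonneg _
  have hLA0 : 0 ≤ LA := by rw [hLA]; split_ifs <;> simp [sitePoly_nonneg]
  have hLB0 : 0 ≤ LB := by rw [hLB]; split_ifs <;> simp [sitePoly_nonneg]
  have hκ : 0 ≤ ω₂ ^ 2 + lam ^ 2 := by positivity
  have hb : 0 ≤ 4 + 64 * β ^ 2 := by positivity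
  have h3 := sq_add_sub_le_three a A B
  have ha2 : a ^ 2 ≤ 2 * (ω₂ ^ 2 + lam ^ 2) * sitePoly (q i) := sq_pinForce_le (q i)
  have hA2 : A ^ 2 ≤ (4 + 64 * β ^ 2) * (sitePoly (q i) + LA) := by
    rw [hA, hLA]
    by_cases h : 0 < i.val
    · simp only [h, dite_true]
      exact sq_bondForce_le _ _
    · simp only [h, dite_false]
      nlinarith [hb, hL0]
  have hB2 : B ^ 2 ≤ (4 + 64 * β ^ 2) * (sitePoly (q i) + LB) := by
    rw [hB, hLB]
    by_cases h : i.val + 1 < N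
    · simp only [h, dite_true]
      have := sq_bondForce_le (β := β) (q ⟨i.val + 1, h⟩) (q i)
      nlinarith [this]
    · simp only [h, dite_false]
      nlinarith [hb, hL0]
  unfold gradConst
  nlinarith [h3, ha2, hA2, hB2, hL0, hLA0, hLB0, hκ, hb, mul_nonneg hb hLA0, mul_nonneg hb hLB0,
    mul_nonneg hκ hLA0, mul_nonneg hκ hLB0, mul_nonneg (sq_nonneg β) hLA0, mul_nonneg (sq_nonneg β) hLB0,
    mul_nonneg (sq_nonneg β) hL0]

/-- `∂ᵢU_N` is continuous (it is a polynomial). [folklore] -/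
theorem continuous_coordDeriv_potEnergy (i : Fin N) : Continuous fun q => coordDeriv i (potEnergy ω₂ lam β N) q := by
  simp only [coordDeriv_potEnergy]
  by_cases h1 : 0 < i.val <;> by_cases h2 : i.val + 1 < N <;> simp only [h1, h2, dite_true, dite_false] <;>
    fun_prop

/-- **Per-site integrated gradient bound**: `(∂ᵢU_N)² w ∈ L¹` and `∫ (∂ᵢU_N)² w ≤ 3K₀(1 + c + 90c³)·Z`,
uniformly in `i` and `N`. [cite: BrascampLieb1976, Thm 4.1] -/
theorem integral_sq_coordDeriv_potEnergy_le (hω : 0 < ω₂) (hl : 0 ≤ lam) (hβ : 0 ≤ β) (hT : 0 < T)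
    (i : Fin N) :
    Integrable (fun q => coordDeriv i (potEnergy ω₂ lam β N) q ^ 2 * potWeight ω₂ lam β T N q) ∧
    ∫ q, coordDeriv i (potEnergy ω₂ lam β N) q ^ 2 * potWeight ω₂ lam β T N q ≤
      3 * gradConst ω₂ lam β * (1 + T / ω₂ + 90 * (T / ω₂) ^ 3) * ∫ q, potWeight ω₂ lam β T N q := by
  set cΛ : ℝ := 1 + T / ω₂ + 90 * (T / ω₂) ^ 3 with hcΛ
  set Z : ℝ := ∫ q, potWeight ω₂ lam β T N q with hZ
  have hZ0 : 0 < Z := integral_potWeight_pos hω hl hβ hT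
  have hc0 : 0 ≤ cΛ := by have := div_pos hT hω; positivity
  have hK := gradConst_nonneg (ω₂ := ω₂) (lam := lam) (β := β)
  -- the dominating function
  set G : (Fin N → ℝ) → ℝ := fun q => gradConst ω₂ lam β * (sitePoly (q i)
        + (if h : 0 < i.val then sitePoly (q ⟨i.val - 1, by omega⟩) else 0)
        + (if h : i.val + 1 < N then sitePoly (q ⟨i.val + 1, h⟩) else 0)) with hG
  have hSi := integral_sitePoly_mul_potWeight_le (N := N) hω hl hβ hT
  have hGA : Integrable (fun q => (if h : 0 < i.val then sitePoly (q ⟨i.val - 1, by omega⟩) else (0:ℝ)) *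
      potWeight ω₂ lam β T N q) ∧
      ∫ q, (if h : 0 < i.val then sitePoly (q ⟨i.val - 1, by omega⟩) else (0:ℝ)) * potWeight ω₂ lam β T N q
        ≤ cΛ * Z := by
    by_cases h : 0 < i.val
    · simp only [h, dite_true]; exact hSi _
    · simp only [h, dite_false, zero_mul, integral_zero]
      exact ⟨integrable_zero _ _ _, by positivity⟩
  have hGB : Integrable (fun q => (if h : i.val + 1 < N then sitePoly (q ⟨i.val + 1, h⟩) else (0:ℝ)) *
      potWeight ω₂ lam β T N q) ∧
      ∫ q, (if h : i.val + 1 < N then sitePoly (q ⟨i.val + 1, h⟩) else (0:ℝ)) * potWeight ω₂ lam β T N q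
        ≤ cΛ * Z := by
    by_cases h : i.val + 1 < N
    · simp only [h, dite_true]; exact hSi _
    · simp only [h, dite_false, zero_mul, integral_zero]
      exact ⟨integrable_zero _ _ _, by positivity⟩
  have hGI : Integrable (fun q => G q * potWeight ω₂ lam β T N q) := by
    have := (((hSi i).1.add hGA.1).add hGB.1).const_mul (gradConst ω₂ lam β)
    refine this.congr (Eventually.of_forall fun q => ?_)
    simp only [hG, Pi.add_apply]
    ring
  have hGint : ∫ q, G q * potWeight ω₂ lam β T N q ≤ 3 * gradConst ω₂ lam β * cΛ * Z := by
    have hA := integral_add (hSi i).1 hGA.1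
    have hB := integral_add ((hSi i).1.add hGA.1) hGB.1
    simp only [Pi.add_apply] at hB
    rw [hA] at hB
    have e : ∫ q, G q * potWeight ω₂ lam β T N q = gradConst ω₂ lam β *
        ∫ q, (sitePoly (q i) * potWeight ω₂ lam β T N q
          + (if h : 0 < i.val then sitePoly (q ⟨i.val - 1, by omega⟩) else (0:ℝ)) *
              potWeight ω₂ lam β T N q)
          + (if h : i.val + 1 < N then sitePoly (q ⟨i.val + 1, h⟩) else (0:ℝ)) *
              potWeight ω₂ lam β T N q := by
      rw [← integral_const_mul]
      refine integral_congr_ae (Eventually.of_forall fun q => ?_)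
      simp only [hG]
      ring
    rw [e, hB]
    nlinarith [(hSi i).2, hGA.2, hGB.2, hK]
  have hle : ∀ q, coordDeriv i (potEnergy ω₂ lam β N) q ^ 2 * potWeight ω₂ lam β T N q ≤
      G q * potWeight ω₂ lam β T N q := fun q =>
    mul_le_mul_of_nonneg_right (sq_coordDeriv_potEnergy_le i q) (potWeight_pos _ _ _ _ _ _).le
  have hI : Integrable (fun q => coordDeriv i (potEnergy ω₂ lam β N) q ^ 2 * potWeight ω₂ lam β T N q) := by
    refine hGI.mono' (((continuous_coordDeriv_potEnergy i).pow 2).mul continuous_potWeight).aestronglyMeasurable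
      (Eventually.of_forall fun q => ?_)
    rw [Real.norm_eq_abs, abs_of_nonneg (mul_nonneg (sq_nonneg _) (potWeight_pos _ _ _ _ _ _).le)]
    exact hle q
  exact ⟨hI, (integral_mono hI hGI hle).trans hGint⟩


/-! ### §V.4 Extensive potential-energy fluctuations in position space -/

/-- **Dirichlet form of `U_N` is extensive**: `∑ᵢ(∂ᵢU_N)² w ∈ L¹` and `∫ (∑ᵢ(∂ᵢU_N)²) w ≤ N·K₁·Z`,
`K₁ = 3K₀(1 + c + 90c³)`. [cite: BrascampLieb1976, Thm 4.1] -/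
theorem integral_sum_sq_coordDeriv_le (hω : 0 < ω₂) (hl : 0 ≤ lam) (hβ : 0 ≤ β) (hT : 0 < T) :
    Integrable (fun q => (∑ i, coordDeriv i (potEnergy ω₂ lam β N) q ^ 2) * potWeight ω₂ lam β T N q) ∧
    ∫ q, (∑ i, coordDeriv i (potEnergy ω₂ lam β N) q ^ 2) * potWeight ω₂ lam β T N q ≤
      (N : ℝ) * (3 * gradConst ω₂ lam β * (1 + T / ω₂ + 90 * (T / ω₂) ^ 3)) *
        ∫ q, potWeight ω₂ lam β T N q := by
  have h := fun i => integral_sq_coordDeriv_potEnergy_le (N := N) hω hl hβ hT i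
  have hI : Integrable (fun q => ∑ i, coordDeriv i (potEnergy ω₂ lam β N) q ^ 2 * potWeight ω₂ lam β T N q) :=
    integrable_finsetSum _ (fun i _ => (h i).1)
  have e : (fun q => (∑ i, coordDeriv i (potEnergy ω₂ lam β N) q ^ 2) * potWeight ω₂ lam β T N q) =
      fun q => ∑ i, coordDeriv i (potEnergy ω₂ lam β N) q ^ 2 * potWeight ω₂ lam β T N q :=
    funext fun q => Finset.sum_mul _ _ _
  rw [e]
  refine ⟨hI, ?_⟩
  rw [integral_finsetSum _ (fun i _ => (h i).1)]
  calc ∑ i, ∫ q, coordDeriv i (potEnergy ω₂ lam β N) q ^ 2 * potWeight ω₂ lam β T N q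
      ≤ ∑ _i : Fin N, 3 * gradConst ω₂ lam β * (1 + T / ω₂ + 90 * (T / ω₂) ^ 3) *
          ∫ q, potWeight ω₂ lam β T N q := Finset.sum_le_sum fun i _ => (h i).2
    _ = _ := by
        rw [Finset.sum_const, Finset.card_univ, Fintype.card_fin, nsmul_eq_mul]
        ring

/-- `U_N w, U_N² w ∈ L¹` (`U ≤ 2T e^{U/(2T)}`, `U² ≤ 8T² e^{U/(2T)}`). [folklore] -/
theorem integrable_potEnergy_mul_potWeight (hω : 0 < ω₂) (hl : 0 ≤ lam) (hβ : 0 ≤ β) (hT : 0 < T) :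
    Integrable (fun q => potEnergy ω₂ lam β N q * potWeight ω₂ lam β T N q) ∧
    Integrable (fun q => potEnergy ω₂ lam β N q ^ 2 * potWeight ω₂ lam β T N q) := by
  have h0 := fun q => potEnergy_nonneg hω.le hl hβ (N := N) q
  refine ⟨integrable_mul_potWeight_of_le hω hl hβ hT continuous_potEnergy (A := 2 * T) (fun q => ?_),
    integrable_mul_potWeight_of_le hω hl hβ hT (continuous_potEnergy.pow 2) (A := 8 * T ^ 2) (fun q => ?_)⟩
  · set u : ℝ := potEnergy ω₂ lam β N q / (2 * T) with hu
    have hU : potEnergy ω₂ lam β N q = 2 * T * u := by rw [hu]; field_simp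
    have hue : u ≤ Real.exp u := by linarith [Real.add_one_le_exp u]
    rw [abs_of_nonneg (h0 q), hU]
    exact mul_le_mul_of_nonneg_left hue (by positivity)
  · set u : ℝ := potEnergy ω₂ lam β N q / (2 * T) with hu
    have hU : potEnergy ω₂ lam β N q = 2 * T * u := by rw [hu]; field_simp
    have hu0 : 0 ≤ u := by rw [hu]; exact div_nonneg (h0 q) (by positivity)
    have h2 := Real.pow_div_factorial_le_exp u hu0 2
    rw [Nat.factorial_two, Nat.cast_ofNat, div_le_iff₀ (by norm_num : (0:ℝ) < 2)] at h2
    rw [abs_of_nonneg (sq_nonneg _), hU]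
    nlinarith [h2, sq_nonneg T]

/-- **Extensive potential fluctuations** (`q`-space): `∫ (U_N − m_U)² w ≤ (T/ω₂)·N·K₁·Z` with
`m_U = (∫ U_N w)/Z` (Brascamp–Lieb for `f = U_N` and §V.4). [cite: BrascampLieb1976, Thm 4.1] -/
theorem potFluct_le (hω : 0 < ω₂) (hl : 0 ≤ lam) (hβ : 0 ≤ β) (hT : 0 < T) :
    ∫ q, (potEnergy ω₂ lam β N q - (∫ q, potEnergy ω₂ lam β N q * potWeight ω₂ lam β T N q) /
        ∫ q, potWeight ω₂ lam β T N q) ^ 2 * potWeight ω₂ lam β T N q ≤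
      T / ω₂ * ((N : ℝ) * (3 * gradConst ω₂ lam β * (1 + T / ω₂ + 90 * (T / ω₂) ^ 3)) *
        ∫ q, potWeight ω₂ lam β T N q) := by
  obtain ⟨h1, h2⟩ := integrable_potEnergy_mul_potWeight (N := N) hω hl hβ hT
  obtain ⟨h3, hsum⟩ := integral_sum_sq_coordDeriv_le (N := N) hω hl hβ hT
  have key := potWeight_poincare hω hl hβ hT N (potEnergy ω₂ lam β N) (contDiff_potEnergy.of_le (by norm_num))
    h1 h2 h3
  exact key.trans (mul_le_mul_of_nonneg_left hsum (div_pos hT hω).le)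

end Position

end EnergyFluctuation

end Summit.AtomisticToContinuum.FouriersLaw.Theorems.BoundedResponse.ParityFloor

end
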